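import Literature.Barriers.QuantumFields.GoldstoneTheorem
import HarnessLib

/-!
# Goldstone's theorem (Kastler–Robinson–Swieca): the energy gap at work

Support file for the discharge of the named fact `Literature.Barriers.QuantumFields.KRSLemmaIV`
(barrier catalogue `Literature/Barriers/QuantumFields/`, file `GoldstoneTheorem`). Here the
gapped spectrum condition 4. of Kastler–Robinson–Swieca (`IsKRS.spectrum`: off the vacuum the
distributional Fourier transform of every matrix coefficient `a ↦ ⟪φ, T(a) ψ⟫` of the
translations vanishes off `(2π)⁻¹ V₊^m`, `V₊^m = {p : p² ≥ m², p⁰ > 0}`) is turned into the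
statement actually consumed by the proof of Lemma IV (`GoldstoneTheoremProofs`):

* `V₊^m ⊆ {p⁰ ≥ m}`, so the ball of radius `m / 2π` misses `(2π)⁻¹ V₊^m`
  (`ball_subset_compl_preimage_forwardMassShellRegion`); hence for every Schwartz `g` supported in
  that ball and every `ψ ⊥ Ω`, `∫ (𝓕 g)(a) ⟪φ, T(a) ψ⟫ da = 0`
  (`integral_fourier_mul_inner_eq_zero`): smearing a positive-energy matrix coefficient in
  space-time with a probe `Φ = 𝓕 g` whose spectral support lies below the mass gap gives zero;
* such probes exist with `g` even and `g(0) = 1`, i.e. `Φ` even with `∫ Φ = 1`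
  (`exists_spectralProbe`, `fourier_neg_of_even`, `integral_fourier_eq`);
* consequently, for current vectors `χ = j⁰(f) Ω`, `χ' = j⁰(f̄) Ω` (both `⊥ Ω` by 5(a)) and a
  bounded `A`, the probe average of the translated charge commutator
  `E(a) = ⟪T(a) χ', A Ω⟫ - ⟪A* Ω, T(a) χ⟫` vanishes, `∫ Φ(a) E(a) da = 0`
  (`integral_fourier_mul_comm_eq_zero`; the first term is `⟪χ', T(-a) (A Ω - ⟨A⟩ Ω)⟫`, a
  reflected positive-energy coefficient, handled by `a ↦ -a` and the evenness of `Φ`);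
* the **tail estimate** converting "`E = q` on a big ball, `E` bounded, `∫ Φ E = 0`" into
  smallness of `q`: `|q| |∫ Φ| ≤ 2 B S⁻ᵏ ∫ |a|ᵏ |Φ(a)| da` (`norm_mul_norm_integral_le`).

This replaces Lemmas II-III of the printed proof (the `(P⁰)ᵏ`-trick) by a direct use of the
spectral support; the mass gap enters exactly through the existence of the probe.

## References

[KastlerRobinsonSwieca1966] §II 4. (3)-(5), 5(a); §III Lemmas III-IV.
-/

noncomputable section

open Filter Topology ComplexConjugate MeasureTheory Set
open scoped InnerProductSpace SchwartzMap FourierTransform RealInnerProductSpace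

namespace Literature.Barriers.QuantumFields

open Literature.MathematicalPhysics.QuantumLattice Literature.Analysis.UnboundedOperators
open LocalNetWithCurrent

/-! ### The gapped mass shell and the spectral probe -/

/-- `V₊^m ⊆ {p : p⁰ ≥ m}`: `m² ≤ (p⁰)² - |p⃗|² ≤ (p⁰)²` and `p⁰ > 0`.
[cite: KastlerRobinsonSwieca1966, §II (5)] -/
theorem le_apply_zero_of_mem_forwardMassShellRegion {m : ℝ} {p : SpaceTime 3}
    (hp : p ∈ forwardMassShellRegion m) : m ≤ p 0 := by
  obtain ⟨h0, hmass⟩ := hp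
  rw [minkowskiForm_self] at hmass
  have h1 : m ^ 2 ≤ p 0 ^ 2 := by nlinarith [sq_nonneg ‖spaceC 3 p‖]
  rcases le_or_gt m 0 with hm | hm
  · exact hm.trans h0.le
  · exact le_of_pow_le_pow_left₀ two_ne_zero h0.le h1

/-- The ball of radius `m / 2π` about the origin misses the rescaled mass shell `(2π)⁻¹ V₊^m`
(the set off which `IsKRS.spectrum` lets the Fourier transforms live). [folklore] -/
theorem ball_subset_compl_preimage_forwardMassShellRegion (m : ℝ) :
    Metric.ball (0 : SpaceTime 3) (m / (2 * Real.pi)) ⊆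
      ((fun ξ : SpaceTime 3 => (2 * Real.pi) • ξ) ⁻¹' forwardMassShellRegion m)ᶜ := by
  intro ξ hξ hmem
  rw [Set.mem_preimage] at hmem
  have h1 := le_apply_zero_of_mem_forwardMassShellRegion hmem
  rw [Metric.mem_ball, dist_zero_right] at hξ
  have h2 : |ξ 0| ≤ ‖ξ‖ := by simpa using PiLp.norm_apply_le ξ 0
  have h3 : ((2 * Real.pi) • ξ) 0 = 2 * Real.pi * ξ 0 := by simp
  rw [h3] at h1
  have hπ : 0 < 2 * Real.pi := by positivity
  rw [lt_div_iff₀ hπ] at hξ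
  have h4 : ξ 0 ≤ |ξ 0| := le_abs_self _
  nlinarith

variable {N : LocalNetWithCurrent}

/-- **The gapped spectrum condition in integral form.** Under `IsKRS m`, for every Schwartz `g`
on momentum space supported in the ball of radius `m / 2π` and all `φ`, `ψ` with `ψ ⊥ Ω`:
`∫ (𝓕 g)(a) ⟪φ, T(a) ψ⟫ da = 0` (unfold `UnitaryRep.fourierMatrixCoeff` in `IsKRS.spectrum`).
[cite: KastlerRobinsonSwieca1966, §II 4. (3)-(5)] -/
theorem integral_fourier_mul_inner_eq_zero {m : ℝ} (hN : N.IsKRS m) {g : 𝓢(SpaceTime 3, ℂ)}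
    (hg : tsupport (g : SpaceTime 3 → ℂ) ⊆ Metric.ball (0 : SpaceTime 3) (m / (2 * Real.pi)))
    (φ ψ : N.H) (hψ : ⟪N.Ω, ψ⟫_ℂ = 0) :
    ∫ a, (𝓕 g : 𝓢(SpaceTime 3, ℂ)) a * ⟪φ, N.T (Multiplicative.ofAdd a) ψ⟫_ℂ = 0 := by
  have h := hN.spectrum φ ψ hψ g
    (hg.trans (ball_subset_compl_preimage_forwardMassShellRegion m))
  simpa [UnitaryRep.fourierMatrixCoeff_apply, UnitaryRep.matrixCoeff_apply] using h

/-- The Fourier transform of an even Schwartz function is even (`𝓕 g (-a) = 𝓕⁻ g (a) = 𝓕 (g ∘ neg) a`).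
[folklore] -/
theorem fourier_neg_of_even {g : 𝓢(SpaceTime 3, ℂ)} (heven : ∀ ξ, g (-ξ) = g ξ)
    (a : SpaceTime 3) : (𝓕 g : 𝓢(SpaceTime 3, ℂ)) (-a) = (𝓕 g : 𝓢(SpaceTime 3, ℂ)) a := by
  rw [SchwartzMap.fourier_coe, ← Real.fourierInv_eq_fourier_neg,
    Real.fourierInv_eq_fourier_comp_neg]
  have h : (fun x => g (-x)) = (g : SpaceTime 3 → ℂ) := funext heven
  rw [h]

/-- `∫ 𝓕 g = g(0)` for Schwartz `g` (Fourier inversion at the origin). [folklore] -/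
theorem integral_fourier_eq (g : 𝓢(SpaceTime 3, ℂ)) :
    ∫ a, (𝓕 g : 𝓢(SpaceTime 3, ℂ)) a = g 0 := by
  have h := congrFun (g.continuous.fourierInv_fourier_eq g.integrable
    ((𝓕 g : 𝓢(SpaceTime 3, ℂ))).integrable) 0
  rw [Real.fourierInv_eq] at h
  rw [← h, SchwartzMap.fourier_coe]
  simp

/-- **Existence of the spectral probe**: for `m > 0` there is a Schwartz function `g` on
momentum space `ℝ^{1+3}`, even, with `g(0) = 1` and supported in the ball of radius `m / 2π` (a
normalised radial bump of outer radius `m / 4π`). Its Fourier transform `Φ = 𝓕 g` is the even,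
unit-mass probe against which the charge commutator is averaged. [folklore] -/
theorem exists_spectralProbe {m : ℝ} (hm : 0 < m) :
    ∃ g : 𝓢(SpaceTime 3, ℂ),
      tsupport (g : SpaceTime 3 → ℂ) ⊆ Metric.ball (0 : SpaceTime 3) (m / (2 * Real.pi)) ∧
      (∀ ξ, g (-ξ) = g ξ) ∧ g 0 = 1 := by
  have hπ : 0 < 2 * Real.pi := by positivity
  have hr : 0 < m / (2 * Real.pi) := div_pos hm hπ
  let c : ContDiffBump (0 : SpaceTime 3) :=
    ⟨m / (2 * Real.pi) / 4, m / (2 * Real.pi) / 2, by positivity, by linarith⟩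
  let g : SpaceTime 3 → ℂ := fun ξ => ((c ξ : ℝ) : ℂ)
  have hgs : ContDiff ℝ (⊤ : ℕ∞) g := Complex.ofRealCLM.contDiff.comp c.contDiff
  have hgc : HasCompactSupport g := c.hasCompactSupport.comp_left (g := fun r : ℝ => (r : ℂ)) rfl
  refine ⟨hgc.toSchwartzMap hgs, ?_, fun ξ => ?_, ?_⟩
  · intro ξ hξ
    have h1 : tsupport g ⊆ tsupport c :=
      tsupport_comp_subset (g := fun r : ℝ => (r : ℂ)) rfl _
    have h2 := h1 hξ
    rw [c.tsupport_eq, Metric.mem_closedBall, dist_zero_right] at h2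
    rw [Metric.mem_ball, dist_zero_right]
    change ‖ξ‖ ≤ m / (2 * Real.pi) / 2 at h2
    linarith
  · change ((c (-ξ) : ℝ) : ℂ) = ((c ξ : ℝ) : ℂ)
    rw [c.neg]
  · change ((c 0 : ℝ) : ℂ) = 1
    rw [c.one_of_mem_closedBall (Metric.mem_closedBall_self (by positivity))]
    simp

variable {N : LocalNetWithCurrent}

/-! ### Matrix coefficients of the translations -/

/-- `⟪T(a) x, y⟫ = ⟪x, T(-a) y⟫` (unitarity, `T(a)* = T(a)⁻¹ = T(-a)`). [folklore] -/
theorem inner_T_left (a : SpaceTime 3) (x y : N.H) :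
    ⟪N.T (Multiplicative.ofAdd a) x, y⟫_ℂ = ⟪x, N.T (Multiplicative.ofAdd (-a)) y⟫_ℂ := by
  have h : N.T (Multiplicative.ofAdd a) (N.T (Multiplicative.ofAdd (-a)) y) = y := by
    change (N.T (Multiplicative.ofAdd a) * N.T (Multiplicative.ofAdd (-a))) y = y
    rw [← map_mul, ← ofAdd_add, add_neg_cancel, ofAdd_zero, map_one]
    rfl
  conv_lhs => rw [← h]
  rw [UnitaryRep.inner_map_map]

/-- `a ↦ ⟪x, T(a) y⟫` is continuous (strong continuity of `T`). [folklore] -/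
theorem continuous_inner_T_right (x y : N.H) :
    Continuous fun a : SpaceTime 3 => ⟪x, N.T (Multiplicative.ofAdd a) y⟫_ℂ :=
  continuous_const.inner ((N.T.continuous_apply_apply y).comp continuous_ofAdd)

/-- `a ↦ ⟪T(a) x, y⟫` is continuous (strong continuity of `T`). [folklore] -/
theorem continuous_inner_T_left (x y : N.H) :
    Continuous fun a : SpaceTime 3 => ⟪N.T (Multiplicative.ofAdd a) x, y⟫_ℂ :=
  ((N.T.continuous_apply_apply x).comp continuous_ofAdd).inner continuous_const

/-- `|⟪x, T(a) y⟫| ≤ |x| |y|` (Cauchy–Schwarz and unitarity). [folklore] -/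
theorem norm_inner_T_right_le (x y : N.H) (a : SpaceTime 3) :
    ‖⟪x, N.T (Multiplicative.ofAdd a) y⟫_ℂ‖ ≤ ‖x‖ * ‖y‖ := by
  simpa using norm_inner_le_norm x (N.T (Multiplicative.ofAdd a) y)

/-- `|⟪T(a) x, y⟫| ≤ |x| |y|` (Cauchy–Schwarz and unitarity). [folklore] -/
theorem norm_inner_T_left_le (x y : N.H) (a : SpaceTime 3) :
    ‖⟪N.T (Multiplicative.ofAdd a) x, y⟫_ℂ‖ ≤ ‖x‖ * ‖y‖ := by
  simpa using norm_inner_le_norm (N.T (Multiplicative.ofAdd a) x) y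

/-- Variant of `integral_fourier_mul_inner_eq_zero` with the support hypothesis stated directly
as `tsupport g ⊆ ((2π •)⁻¹ V₊^m)ᶜ`. [cite: KastlerRobinsonSwieca1966, §II 4. (3)-(5)] -/
theorem integral_fourier_mul_inner_eq_zero' {m : ℝ} (hN : N.IsKRS m) {g : 𝓢(SpaceTime 3, ℂ)}
    (hg : tsupport (g : SpaceTime 3 → ℂ) ⊆
      ((fun ξ : SpaceTime 3 => (2 * Real.pi) • ξ) ⁻¹' forwardMassShellRegion m)ᶜ)
    (φ ψ : N.H) (hψ : ⟪N.Ω, ψ⟫_ℂ = 0) :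
    ∫ a, (𝓕 g : 𝓢(SpaceTime 3, ℂ)) a * ⟪φ, N.T (Multiplicative.ofAdd a) ψ⟫_ℂ = 0 := by
  have h := hN.spectrum φ ψ hψ g hg
  simpa [UnitaryRep.fourierMatrixCoeff_apply, UnitaryRep.matrixCoeff_apply] using h

/-! ### The probe average of the charge commutator vanishes -/

/-- **The energy gap kills the probe average of the charge commutator.** Under `IsKRS m`, let
`g` be a Schwartz function on momentum space supported off `(2π)⁻¹ V₊^m` with `𝓕 g` even, let
`χ, χ' ⊥ Ω` (the current vectors `j⁰(f) Ω`, `j⁰(f̄) Ω`, orthogonal to `Ω` by 5(a)) and `A`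
bounded. Then `∫ (𝓕 g)(a) (⟪T(a) χ', A Ω⟫ - ⟪A* Ω, T(a) χ⟫) da = 0`: the second term is a
positive-energy matrix coefficient smeared below the gap; the first equals
`⟪χ', T(-a) (A Ω - ⟪Ω, A Ω⟫ Ω)⟫` (vacuum invariance, `χ' ⊥ Ω`, `‖Ω‖ = 1`), and after `a ↦ -a`
and evenness of `𝓕 g` it is of the same kind. This is where the assumption `m > 0` of Lemma IV
enters ("Lemma IV depends upon our assumption that the smallest mass `m` is greater than zero").
[cite: KastlerRobinsonSwieca1966, §III Lemma IV with §II 4.] -/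
theorem integral_fourier_mul_comm_eq_zero {m : ℝ} (hN : N.IsKRS m) {g : 𝓢(SpaceTime 3, ℂ)}
    (hg : tsupport (g : SpaceTime 3 → ℂ) ⊆
      ((fun ξ : SpaceTime 3 => (2 * Real.pi) • ξ) ⁻¹' forwardMassShellRegion m)ᶜ)
    (heven : ∀ a, (𝓕 g : 𝓢(SpaceTime 3, ℂ)) (-a) = (𝓕 g : 𝓢(SpaceTime 3, ℂ)) a)
    {χ χ' : N.H} (hχ : ⟪N.Ω, χ⟫_ℂ = 0) (hχ' : ⟪N.Ω, χ'⟫_ℂ = 0) (A : N.H →L[ℂ] N.H) :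
    ∫ a, (𝓕 g : 𝓢(SpaceTime 3, ℂ)) a *
      (⟪N.T (Multiplicative.ofAdd a) χ', A N.Ω⟫_ℂ -
        ⟪(star A) N.Ω, N.T (Multiplicative.ofAdd a) χ⟫_ℂ) = 0 := by
  set Φ : 𝓢(SpaceTime 3, ℂ) := 𝓕 g with hΦ
  -- the vector `A Ω` minus its vacuum component
  set c : ℂ := ⟪N.Ω, A N.Ω⟫_ℂ with hc
  set ψ : N.H := A N.Ω - c • N.Ω with hψ
  have hψ0 : ⟪N.Ω, ψ⟫_ℂ = 0 := by
    simp only [hψ, inner_sub_right, inner_smul_right, inner_self_eq_norm_sq_to_K,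
      hN.norm_vacuum]
    simp [hc]
  have hP : ∀ a, ⟪N.T (Multiplicative.ofAdd a) χ', A N.Ω⟫_ℂ =
      ⟪χ', N.T (Multiplicative.ofAdd (-a)) ψ⟫_ℂ := by
    intro a
    have hχ'Ω : ⟪χ', N.Ω⟫_ℂ = 0 := by rw [← inner_conj_symm, hχ', map_zero]
    have hdec : A N.Ω = ψ + c • N.Ω := by simp [hψ]
    rw [inner_T_left, hdec, map_add, map_smul, hN.vacuum_invariant, inner_add_right,
      inner_smul_right, hχ'Ω, mul_zero, add_zero]
  -- integrability of the two pieces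
  have hΦi : Integrable (Φ : SpaceTime 3 → ℂ) := Φ.integrable
  have hI1 : Integrable fun a => Φ a * ⟪N.T (Multiplicative.ofAdd a) χ', A N.Ω⟫_ℂ :=
    hΦi.mul_bdd (continuous_inner_T_left χ' (A N.Ω)).aestronglyMeasurable
      (ae_of_all _ (norm_inner_T_left_le χ' (A N.Ω)))
  have hI2 : Integrable fun a => Φ a * ⟪(star A) N.Ω, N.T (Multiplicative.ofAdd a) χ⟫_ℂ :=
    hΦi.mul_bdd (continuous_inner_T_right ((star A) N.Ω) χ).aestronglyMeasurable
      (ae_of_all _ (norm_inner_T_right_le ((star A) N.Ω) χ))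
  simp only [mul_sub]
  rw [integral_sub hI1 hI2, integral_fourier_mul_inner_eq_zero' hN hg _ χ hχ, sub_zero]
  -- the first piece: reflect `a ↦ -a` and use evenness of `Φ`
  simp only [hP]
  have hrefl := integral_neg_eq_self
    (fun a : SpaceTime 3 => Φ (-a) * ⟪χ', N.T (Multiplicative.ofAdd a) ψ⟫_ℂ) volume
  simp only [neg_neg] at hrefl
  rw [hrefl]
  simp only [heven]
  exact integral_fourier_mul_inner_eq_zero' hN hg χ' ψ hψ0

/-! ### The tail estimate -/

/-- **Tail estimate.** If `E` is continuous with `|E| ≤ B`, constant `= q` on the ball `|a| < S`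
(`S > 0`), and its average against a Schwartz probe vanishes, `∫ Φ E = 0`, then
`|q| · |∫ Φ| ≤ 2 B S⁻ᵏ ∫ |a|ᵏ |Φ(a)| da` for every `k`: indeed `q ∫ Φ = ∫ Φ (q - E)` and
`|q - E(a)| ≤ 2B (|a|/S)ᵏ` everywhere. [folklore] -/
theorem norm_mul_norm_integral_le (Φ : 𝓢(SpaceTime 3, ℂ)) {E : SpaceTime 3 → ℂ}
    (hE : Continuous E) {B S : ℝ} (hS : 0 < S) (hB : ∀ a, ‖E a‖ ≤ B) {q : ℂ}
    (hq : ∀ a, ‖a‖ < S → E a = q) (hint : ∫ a, Φ a * E a = 0) (k : ℕ) :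
    ‖q‖ * ‖∫ a, Φ a‖ ≤ 2 * B * (S ^ k)⁻¹ * ∫ a, ‖a‖ ^ k * ‖Φ a‖ := by
  have hq0 : ‖q‖ ≤ B := by
    rw [← hq 0 (by simpa using hS)]
    exact hB 0
  have hB0 : 0 ≤ B := (norm_nonneg _).trans hq0
  have hΦi : Integrable (Φ : SpaceTime 3 → ℂ) := Φ.integrable
  have hI : Integrable fun a => Φ a * E a :=
    hΦi.mul_bdd hE.aestronglyMeasurable (ae_of_all _ hB)
  have hIq : Integrable fun a => Φ a * q := hΦi.mul_const q
  -- pointwise bound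
  have hpt : ∀ a, ‖Φ a * (q - E a)‖ ≤ 2 * B * (S ^ k)⁻¹ * (‖a‖ ^ k * ‖Φ a‖) := by
    intro a
    rw [norm_mul]
    rcases lt_or_ge ‖a‖ S with ha | ha
    · rw [hq a ha, sub_self, norm_zero, mul_zero]
      positivity
    · have h1 : ‖q - E a‖ ≤ 2 * B := by
        calc ‖q - E a‖ ≤ ‖q‖ + ‖E a‖ := norm_sub_le _ _
          _ ≤ B + B := add_le_add hq0 (hB a)
          _ = 2 * B := by ring
      have h2 : 1 ≤ (S ^ k)⁻¹ * ‖a‖ ^ k := by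
        rw [inv_mul_eq_div, one_le_div (by positivity)]
        exact pow_le_pow_left₀ hS.le ha k
      calc ‖Φ a‖ * ‖q - E a‖ ≤ ‖Φ a‖ * (2 * B) := by gcongr
        _ ≤ ‖Φ a‖ * (2 * B) * ((S ^ k)⁻¹ * ‖a‖ ^ k) :=
            le_mul_of_one_le_right (by positivity) h2
        _ = 2 * B * (S ^ k)⁻¹ * (‖a‖ ^ k * ‖Φ a‖) := by ring
  have hbound : Integrable fun a => 2 * B * (S ^ k)⁻¹ * (‖a‖ ^ k * ‖Φ a‖) :=
    (Φ.integrable_pow_mul volume k).const_mul _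
  calc ‖q‖ * ‖∫ a, Φ a‖ = ‖∫ a, Φ a * q‖ := by
        rw [integral_mul_const, norm_mul, mul_comm]
    _ = ‖∫ a, Φ a * (q - E a)‖ := by
        simp only [mul_sub]
        rw [integral_sub hIq hI, hint, sub_zero]
    _ ≤ ∫ a, 2 * B * (S ^ k)⁻¹ * (‖a‖ ^ k * ‖Φ a‖) :=
        norm_integral_le_of_norm_le hbound (ae_of_all _ hpt)
    _ = 2 * B * (S ^ k)⁻¹ * ∫ a, ‖a‖ ^ k * ‖Φ a‖ := integral_const_mul _ _

end Literature.Barriers.QuantumFields
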